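import Literature.Computability.ImplicitComplexity.SoftTypeAssignmentWeighted
import HarnessLib

/-!
# Strengthening: `STA₊` derivations restricted to the free variables of their subject

Continuation of `SoftTypeAssignmentWeighted.lean` (GMR08 = Gaboardi–Marion–Ronchi Della Rocca 2008).
An `STA₊` context may carry assumptions on variables that do not occur in the subject (introduced
by `(w)`, or by a multiplexor `(m)` contracting absent variables). They can always be dropped:

* `WTyping.strengthen` — `Π ▹ Γ ⊢ M : σ` implies `Γ↾FV(M) ⊢ M : σ` with the same degree, rank
  bound and weight (`Ctx.restrict`); this is the normalisation implicit in GMR08 Property 1/2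
  ("… followed by rules `(w)` and `(m)` working on variables not occurring in `M`") and in the
  definition of the rank ("the number of variables `xᵢ` … such that `xᵢ ∈ FV(M)`", §3.1);
* `Typing.exists_wtyping` — the bridge from the tree's judgement: a derivation of
  `STA.Typing d Γ M σ` yields a weighted derivation of `Γ↾FV(M) ⊢ M : σ` of the same degree with
  every multiplexor of rank `≤ |M|` (after discarding the contracted variables that do not occur,
  a multiplexor contracts at most `|FV| ≤ |M|` slots), for any rank bound `r ≥ |M|`; in
  particular closed programs `⊢ M : σ` have weighted derivations with `r = |M|`
  (`Typing.exists_wtyping_empty`), to which the bound `W ≤ |M| · r^d` applies.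

## References

* [GaboardiMarionRonchidellarocca2008] GMR08, §3.1 (rank counts free variables), Property 1,
  Property 2, Def. A.1.
-/

namespace Literature.Computability.ImplicitComplexity

namespace STA

/-- `Γ↾F`: keep the assumptions on the slots in `F` only. [folklore] -/
def Ctx.restrict (Γ : Ctx) (F : Finset ℕ) : Ctx := fun i => if i ∈ F then Γ i else none

/-- Value of a restricted context. [folklore] -/
@[simp] theorem Ctx.restrict_apply (Γ : Ctx) (F : Finset ℕ) (i : ℕ) :
    Γ.restrict F i = if i ∈ F then Γ i else none := rfl

/-- Restricting the empty context. [folklore] -/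
@[simp] theorem Ctx.restrict_empty (F : Finset ℕ) : Ctx.empty.restrict F = Ctx.empty := by
  funext i
  simp [Ctx.empty]

/-- Free variables of a multiplexed term, off the contracted slots and the fresh one. [folklore] -/
theorem Term.mem_fv_rename_mpxRen_iff {M : Term} {S : Finset ℕ} {j i : ℕ} (hiS : i ∉ S) (hij : i ≠ j) :
    i ∈ (M.rename (mpxRen S j)).fv ↔ i ∈ M.fv := by
  rw [Term.mem_fv_rename]
  constructor
  · rintro ⟨i₀, hi₀, e⟩
    by_cases h0 : i₀ ∈ S
    · rw [mpxRen_of_mem h0] at e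
      exact absurd e.symm hij
    · rw [mpxRen_of_not_mem h0] at e
      exact e ▸ hi₀
  · exact fun hi => ⟨i, hi, mpxRen_of_not_mem hiS⟩

/-- The fresh slot of a multiplexor is free in the multiplexed term as soon as one contracted
variable occurs. [folklore] -/
theorem Term.mem_fv_rename_mpxRen_self {M : Term} {S : Finset ℕ} (j : ℕ) {i₀ : ℕ} (hS : i₀ ∈ S)
    (hM : i₀ ∈ M.fv) : j ∈ (M.rename (mpxRen S j)).fv :=
  Term.mem_fv_rename.2 ⟨i₀, hM, mpxRen_of_mem hS⟩

namespace WTyping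

variable {r : ℕ}

/-- **Strengthening**: the assumptions on variables not free in the subject can be dropped,
keeping degree, rank bound and weight. [cite: GaboardiMarionRonchidellarocca2008, Property 2 and §3.1] -/
theorem strengthen {w d : ℕ} {Γ : Ctx} {M : Term} {σ : SoftTy} (h : WTyping r w d Γ M σ) :
    WTyping r w d (Γ.restrict M.fv) M σ := by
  induction h with
  | @ax Γ i A hΓ =>
    refine WTyping.ax ⟨by simp [hΓ.1], fun j hj => ?_⟩
    simp [hj]
  | @weak w d Γ Γ' M τ j A hM hj hΓ' ih =>
    subst hΓ'
    have hjM : j ∉ M.fv := hM.not_mem_fv_of_eq_none hj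
    refine ih.of_eq_ctx ?_
    funext i
    by_cases hi : i ∈ M.fv
    · have hij : i ≠ j := fun e => hjM (e ▸ hi)
      simp [hi, Function.update_of_ne hij]
    · simp [hi]
  | @lam w d Γ M k B A _ ih =>
    refine WTyping.lam ?_
    by_cases h0 : 0 ∈ M.fv
    · refine ih.of_eq_ctx ?_
      funext i
      cases i with
      | zero => simp [Ctx.cons, h0]
      | succ i => simp [Ctx.cons]
    · have e : (Ctx.cons (some ⟨k, B⟩) Γ).restrict M.fv = Ctx.cons none (Γ.restrict (Term.lam M).fv) := by
        funext i
        cases i with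
        | zero => simp [Ctx.cons, h0]
        | succ i => simp [Ctx.cons]
      refine ((ih.of_eq_ctx e).weaken (j := 0) rfl ⟨k, B⟩).of_eq_ctx ?_
      funext i
      cases i <;> simp [Ctx.cons]
  | @app w₁ w₂ d₁ d₂ Γ Γ₁ Γ₂ M N k B A hs h₁ h₂ ih₁ ih₂ =>
    refine WTyping.app (fun i => ?_) ih₁ ih₂
    by_cases hiM : i ∈ M.fv
    · have hne : Γ₁ i ≠ none := h₁.ne_none_of_mem_fv hiM
      obtain ⟨e1, e2⟩ := hs.left_of_ne_none hne
      have hiN : i ∉ N.fv := fun hiN => h₂.ne_none_of_mem_fv hiN e2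
      exact Or.inl ⟨by simp [hiM, hiN, e1], by simp [hiN]⟩
    · by_cases hiN : i ∈ N.fv
      · have hne : Γ₂ i ≠ none := h₂.ne_none_of_mem_fv hiN
        obtain ⟨_, e2⟩ := hs.right_of_ne_none hne
        exact Or.inr ⟨by simp [hiM], by simp [hiM, hiN, e2]⟩
      · exact Or.inl ⟨by simp [hiM, hiN], by simp [hiN]⟩
  | @mpx w d Γ Γ' M M' μ σ S j hM hS hj hr hΓ' hM' ih =>
    subst hΓ' hM'
    have hjS : j ∉ S := fun h => by simpa [hj] using hS j h
    by_cases hS' : ∃ i ∈ S, i ∈ M.fv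
    · refine WTyping.mpx (σ := σ) (S.filter fun i => i ∈ M.fv) j ih ?_ ?_ ((Finset.card_filter_le _ _).trans hr) ?_ ?_
      · intro i hi
        obtain ⟨hiS, hiM⟩ := Finset.mem_filter.1 hi
        simp [hiM, hS i hiS]
      · simp [hj]
      · funext i
        by_cases hiS' : i ∈ S.filter fun i => i ∈ M.fv
        · obtain ⟨hiS, _⟩ := Finset.mem_filter.1 hiS'
          rw [Ctx.mpx_of_mem _ σ hiS']
          simp [Ctx.mpx_of_mem Γ σ hiS]
        · by_cases hij : i = j
          · subst hij
            obtain ⟨i₀, hi₀S, hi₀M⟩ := hS'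
            have hjS' : i ∉ S.filter fun i => i ∈ M.fv := fun h => hjS (Finset.mem_filter.1 h).1
            rw [Ctx.mpx_self _ σ hjS']
            simp [Ctx.mpx_self Γ σ hjS, Term.mem_fv_rename_mpxRen_self i hi₀S hi₀M]
          · by_cases hiS : i ∈ S
            · have hiM : i ∉ M.fv := fun hiM => hiS' (Finset.mem_filter.2 ⟨hiS, hiM⟩)
              rw [Ctx.mpx_of_ne _ σ hiS' hij]
              simp [Ctx.mpx_of_mem Γ σ hiS, hiM]
            · rw [Ctx.mpx_of_ne _ σ hiS' hij]
              simp [Ctx.mpx_of_ne Γ σ hiS hij, Term.mem_fv_rename_mpxRen_iff hiS hij]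
      · refine Term.rename_congr_fv fun i hi => ?_
        by_cases hiS : i ∈ S
        · rw [mpxRen_of_mem hiS, mpxRen_of_mem (Finset.mem_filter.2 ⟨hiS, hi⟩)]
        · rw [mpxRen_of_not_mem hiS, mpxRen_of_not_mem fun h => hiS (Finset.mem_filter.1 h).1]
    · push Not at hS'
      have eM : M.rename (mpxRen S j) = M := Term.rename_mpxRen_of_disjoint j fun i hi hiS => hS' i hiS hi
      rw [eM]
      refine ih.of_eq_ctx ?_
      funext i
      by_cases hiM : i ∈ M.fv
      · have hiS : i ∉ S := fun h => hS' i h hiM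
        have hij : i ≠ j := fun e => (hM.ne_none_of_mem_fv hiM) (e ▸ hj)
        simp [hiM, Ctx.mpx_of_ne Γ σ hiS hij]
      · simp [hiM]
  | @sp w d Γ Γ' M k A _ hΓ' ih =>
    subst hΓ'
    refine WTyping.sp ih ?_
    funext i
    by_cases hi : i ∈ M.fv <;> simp [Ctx.bang, hi]
  | @allI w d Γ Δ M A _ hΔ ih =>
    subst hΔ
    refine WTyping.allI ih ?_
    funext i
    by_cases hi : i ∈ M.fv <;> simp [Ctx.shift, hi]
  | allE A _ ih => exact WTyping.allE A ih
  | @sum w₁ w₂ d₁ d₂ Γ M N A _ _ ih₁ ih₂ =>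
    have hF : ∀ i, (Γ.restrict (Term.sum M N).fv) i ≠ none → i ∈ (Term.sum M N).fv := by
      intro i hi
      by_contra h
      exact hi (by simp only [Ctx.restrict_apply, if_neg h])
    have e₁ : (Γ.restrict M.fv).join (Γ.restrict (Term.sum M N).fv) = Γ.restrict (Term.sum M N).fv := by
      funext i
      by_cases hi : i ∈ M.fv <;> simp [Ctx.join, hi]
    have e₂ : (Γ.restrict N.fv).join (Γ.restrict (Term.sum M N).fv) = Γ.restrict (Term.sum M N).fv := by
      funext i
      by_cases hi : i ∈ N.fv <;> simp [Ctx.join, hi]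
    exact WTyping.sum ((ih₁.weaken_join _ _ hF).of_eq_ctx e₁) ((ih₂.weaken_join _ _ hF).of_eq_ctx e₂)

/-- Closed derivations stay closed after strengthening (trivial restatement). [folklore] -/
theorem strengthen_empty {w d : ℕ} {M : Term} {σ : SoftTy} (h : WTyping r w d Ctx.empty M σ) :
    WTyping r w d Ctx.empty M σ := h

end WTyping

/-! ### From `Typing` to weighted derivations of bounded rank -/

/-- **Bridge from the tree's judgement.** A derivation of `STA.Typing d Γ M σ` yields, for every
rank bound `r ≥ |M|`, a weighted derivation of `Γ↾FV(M) ⊢ M : σ` of the same degree, in which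
every multiplexor contracts only occurring variables (hence at most `|FV| ≤ |M| ≤ r` of them).
[cite: GaboardiMarionRonchidellarocca2008, §3.1 (rank) and Property 2] -/
theorem Typing.exists_wtyping {d : ℕ} {Γ : Ctx} {M : Term} {σ : SoftTy} (h : Typing d Γ M σ)
    {r : ℕ} (hr : M.size ≤ r) : ∃ w, WTyping r w d (Γ.restrict M.fv) M σ := by
  induction h generalizing r with
  | @ax Γ i A hΓ =>
    refine ⟨1, WTyping.ax ⟨by simp [hΓ.1], fun j hj => ?_⟩⟩
    simp [hj]
  | @weak d Γ Γ' M τ j A _ hj hΓ' ih =>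
    subst hΓ'
    obtain ⟨w, ih⟩ := ih hr
    have hjM : j ∉ M.fv := ih.not_mem_fv_of_eq_none (by simp [hj])
    refine ⟨w, ih.of_eq_ctx ?_⟩
    funext i
    by_cases hi : i ∈ M.fv
    · have hij : i ≠ j := fun e => hjM (e ▸ hi)
      simp [hi, Function.update_of_ne hij]
    · simp [hi]
  | @lam d Γ M k B A _ ih =>
    obtain ⟨w, ih⟩ := ih (r := r) (by simp [Term.size] at hr; omega)
    refine ⟨w + 1, WTyping.lam ?_⟩
    by_cases h0 : 0 ∈ M.fv
    · refine ih.of_eq_ctx ?_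
      funext i
      cases i with
      | zero => simp [Ctx.cons, h0]
      | succ i => simp [Ctx.cons]
    · have e : (Ctx.cons (some ⟨k, B⟩) Γ).restrict M.fv = Ctx.cons none (Γ.restrict (Term.lam M).fv) := by
        funext i
        cases i with
        | zero => simp [Ctx.cons, h0]
        | succ i => simp [Ctx.cons]
      refine ((ih.of_eq_ctx e).weaken (j := 0) rfl ⟨k, B⟩).of_eq_ctx ?_
      funext i
      cases i <;> simp [Ctx.cons]
  | @app d₁ d₂ Γ Γ₁ Γ₂ M N k B A hs _ _ ih₁ ih₂ =>
    obtain ⟨w₁, ih₁⟩ := ih₁ (r := r) (by simp [Term.size] at hr; omega)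
    obtain ⟨w₂, ih₂⟩ := ih₂ (r := r) (by simp [Term.size] at hr; omega)
    refine ⟨w₁ + w₂ + 1, WTyping.app (fun i => ?_) ih₁ ih₂⟩
    by_cases hiM : i ∈ M.fv
    · have hne : Γ₁ i ≠ none := fun e => ih₁.ne_none_of_mem_fv hiM (by simp [hiM, e])
      obtain ⟨e1, e2⟩ := hs.left_of_ne_none hne
      have hiN : i ∉ N.fv := fun hiN => ih₂.ne_none_of_mem_fv hiN (by simp [hiN, e2])
      exact Or.inl ⟨by simp [hiM, hiN, e1], by simp [hiN]⟩
    · by_cases hiN : i ∈ N.fv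
      · have hne : Γ₂ i ≠ none := fun e => ih₂.ne_none_of_mem_fv hiN (by simp [hiN, e])
        obtain ⟨_, e2⟩ := hs.right_of_ne_none hne
        exact Or.inr ⟨by simp [hiM], by simp [hiM, hiN, e2]⟩
      · exact Or.inl ⟨by simp [hiM, hiN], by simp [hiN]⟩
  | @mpx d Γ Γ' M M' μ σ S j _ hS hj hΓ' hM' ih =>
    subst hΓ' hM'
    rw [Term.size_rename] at hr
    obtain ⟨w, ih⟩ := ih hr
    have hjS : j ∉ S := fun h => by simpa [hj] using hS j h
    refine ⟨w, ?_⟩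
    by_cases hS' : ∃ i ∈ S, i ∈ M.fv
    · have hcard : (S.filter fun i => i ∈ M.fv).card ≤ r :=
        (Finset.card_le_card (fun i hi => (Finset.mem_filter.1 hi).2)).trans
          ((Term.card_fv_le_size M).trans hr)
      refine WTyping.mpx (σ := σ) (S.filter fun i => i ∈ M.fv) j ih ?_ ?_ hcard ?_ ?_
      · intro i hi
        obtain ⟨hiS, hiM⟩ := Finset.mem_filter.1 hi
        simp [hiM, hS i hiS]
      · simp [hj]
      · funext i
        by_cases hiS' : i ∈ S.filter fun i => i ∈ M.fv
        · obtain ⟨hiS, _⟩ := Finset.mem_filter.1 hiS'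
          rw [Ctx.mpx_of_mem _ σ hiS']
          simp [Ctx.mpx_of_mem Γ σ hiS]
        · by_cases hij : i = j
          · subst hij
            obtain ⟨i₀, hi₀S, hi₀M⟩ := hS'
            have hjS' : i ∉ S.filter fun i => i ∈ M.fv := fun h => hjS (Finset.mem_filter.1 h).1
            rw [Ctx.mpx_self _ σ hjS']
            simp [Ctx.mpx_self Γ σ hjS, Term.mem_fv_rename_mpxRen_self i hi₀S hi₀M]
          · by_cases hiS : i ∈ S
            · have hiM : i ∉ M.fv := fun hiM => hiS' (Finset.mem_filter.2 ⟨hiS, hiM⟩)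
              rw [Ctx.mpx_of_ne _ σ hiS' hij]
              simp [Ctx.mpx_of_mem Γ σ hiS, hiM]
            · rw [Ctx.mpx_of_ne _ σ hiS' hij]
              simp [Ctx.mpx_of_ne Γ σ hiS hij, Term.mem_fv_rename_mpxRen_iff hiS hij]
      · refine Term.rename_congr_fv fun i hi => ?_
        by_cases hiS : i ∈ S
        · rw [mpxRen_of_mem hiS, mpxRen_of_mem (Finset.mem_filter.2 ⟨hiS, hi⟩)]
        · rw [mpxRen_of_not_mem hiS, mpxRen_of_not_mem fun h => hiS (Finset.mem_filter.1 h).1]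
    · push Not at hS'
      have eM : M.rename (mpxRen S j) = M := Term.rename_mpxRen_of_disjoint j fun i hi hiS => hS' i hiS hi
      rw [eM]
      refine ih.of_eq_ctx ?_
      funext i
      by_cases hiM : i ∈ M.fv
      · have hiS : i ∉ S := fun h => hS' i h hiM
        have hij : i ≠ j := fun e => ih.ne_none_of_mem_fv hiM (by subst e; simp [hiM, hj])
        simp [hiM, Ctx.mpx_of_ne Γ σ hiS hij]
      · simp [hiM]
  | @sp d Γ Γ' M k A _ hΓ' ih =>
    subst hΓ'
    obtain ⟨w, ih⟩ := ih hr
    refine ⟨r * w, WTyping.sp ih ?_⟩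
    funext i
    by_cases hi : i ∈ M.fv <;> simp [Ctx.bang, hi]
  | @allI d Γ Δ M A _ hΔ ih =>
    subst hΔ
    obtain ⟨w, ih⟩ := ih hr
    refine ⟨w, WTyping.allI ih ?_⟩
    funext i
    by_cases hi : i ∈ M.fv <;> simp [Ctx.shift, hi]
  | allE A _ ih =>
    obtain ⟨w, ih⟩ := ih hr
    exact ⟨w, WTyping.allE A ih⟩
  | @sum d₁ d₂ Γ M N A _ _ ih₁ ih₂ =>
    obtain ⟨w₁, ih₁⟩ := ih₁ (r := r) (by simp [Term.size] at hr; omega)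
    obtain ⟨w₂, ih₂⟩ := ih₂ (r := r) (by simp [Term.size] at hr; omega)
    have hF : ∀ i, (Γ.restrict (Term.sum M N).fv) i ≠ none → i ∈ (Term.sum M N).fv := by
      intro i hi
      by_contra h
      exact hi (by simp only [Ctx.restrict_apply, if_neg h])
    have e₁ : (Γ.restrict M.fv).join (Γ.restrict (Term.sum M N).fv) = Γ.restrict (Term.sum M N).fv := by
      funext i
      by_cases hi : i ∈ M.fv <;> simp [Ctx.join, hi]
    have e₂ : (Γ.restrict N.fv).join (Γ.restrict (Term.sum M N).fv) = Γ.restrict (Term.sum M N).fv := by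
      funext i
      by_cases hi : i ∈ N.fv <;> simp [Ctx.join, hi]
    exact ⟨_, WTyping.sum ((ih₁.weaken_join _ _ hF).of_eq_ctx e₁) ((ih₂.weaken_join _ _ hF).of_eq_ctx e₂)⟩

/-- Closed programs: `⊢ M : σ` in `STA.Typing` with degree `d` gives a weighted derivation with rank
bound `|M|` (or any larger `r`) in the empty context. [cite: GaboardiMarionRonchidellarocca2008, §3.1] -/
theorem Typing.exists_wtyping_empty {d : ℕ} {M : Term} {σ : SoftTy} (h : Typing d Ctx.empty M σ)
    {r : ℕ} (hr : M.size ≤ r) : ∃ w, WTyping r w d Ctx.empty M σ := by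
  simpa using h.exists_wtyping hr

/-- `STA.Typing` and the weighted judgement define the same typability of closed terms (at rank
bounds `≥ |M|`). [cite: GaboardiMarionRonchidellarocca2008, Table 2, Table 5] -/
theorem typing_empty_iff_exists_wtyping {d : ℕ} {M : Term} {σ : SoftTy} {r : ℕ} (hr : M.size ≤ r) :
    Typing d Ctx.empty M σ ↔ ∃ w, WTyping r w d Ctx.empty M σ :=
  ⟨fun h => h.exists_wtyping_empty hr, fun ⟨_, h⟩ => h.typing⟩

end STA

end Literature.Computability.ImplicitComplexity
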